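import Summits.Ventures.PackingBounds.Energy.TenPointCkElevenDefs
import HarnessLib

/-!
# `TenPointCkEleven`: the value of the bound `10(9c - F(1,1,1) - A(1)) = 9886638835/30233088`

Framing: lottery ticket; floor = certified bounds/negative ranges. Venture `PackingBounds`, cell
`pub-packcert`, energy family E3PT (pub-packcert-energy gen 13; n = 4 kernel route = KERNEL-D6 data route + `threePointF 4`).
-/

noncomputable section

namespace Summit.Ventures.PackingBounds.Energy.TenPointCkEleven

set_option maxRecDepth 20000 in
set_option maxHeartbeats 400000000 in
/-- The value of the bound: `10(9c - F(1,1,1) - A(1)) = 9886638835/30233088` (the `(1+t)^11`-energy of the configuration 'Petersen code (4,10,1/6)' over ordered pairs). -/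
theorem bound_eqT11 : (10 : ℝ) * ((10 - 1) * c0KT11 - FexpKT11 1 1 1 - aPolyKT11 1) = ((9886638835 : ℝ)/30233088) := by
  unfold c0KT11 FexpKT11 aPolyKT11 a1KT11 a2KT11; ring

end Summit.Ventures.PackingBounds.Energy.TenPointCkEleven
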